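import Summits.AnomalousDissipation.AnomalousDissipation.Theorems.SolenoidalFractalHomogenisationLagrangianStepFrameSolenoidal
import HarnessLib

/-!
# K1L_D (stmt-AnomalousDissipation-27980), `stub_Z7_alphaBeta` α-provider, target (C0) of memo L15: the DERIVATIVE GROUP LAW of the window
# flow at ALL times and the invertibility of the frame Jacobian (helper; `--supports … --as helper`; lead-k1l-onelevel-p1 g5)

For a `LevelRegular` carrier the flow maps invert each other for ALL times (`X m t' s ∘ X m s t' = id`, (F2)); both are smooth displacement maps
`y ↦ y + proj (disp …)` ((F1b)).  Hence the `E`-valued map `F y := disp m s t' y + disp m t' s (X m s t' y)` has `proj ∘ F = 0`, i.e. takes values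
in the lattice; being continuous it is LOCALLY CONSTANT (lattice vectors at distance `< 1` coincide), so its torus derivative vanishes, and the
chain rule for displacement maps (`LagrangianCarrier.fderiv_comp_displacement`) turns `D F = 0` into
**`flowDeriv m t' s (X m s t' y) (flowDeriv m s t' y w) = w`** (`flowDeriv_comp_inverse_apply`) — the (hInv) hypothesis of
`FrameConj.isWeaklyDivFree_distort_frameRead_iff` (p699106) at all times, and with it **`isUnit_frameJac`** (the (hU) hypothesis) at all times.
No window restriction, no connectedness argument.  NOT a proof of the stub, of the crux, or of AD; rung F-D1.A0.
-/

set_option linter.dupNamespace false  -- the summit-side namespace `Summit.AnomalousDissipation.AnomalousDissipation.…` repeats a component by design (D-0017)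

noncomputable section

namespace Summit.AnomalousDissipation.AnomalousDissipation.Theorems.SolenoidalFractalHomogenisation.LagrangianStep.FrameConj

open Literature.Analysis Literature.Analysis.FluidPDE Literature.Analysis.FunctionSpaces Literature.Analysis.FunctionSpaces.Torus
open MeasureTheory Set Filter Topology
open Literature.Analysis.FluidPDE.LatticeShear (LagrangianLatticeCarrier)
open Summit.AnomalousDissipation.AnomalousDissipation.Theorems.SolenoidalFractalHomogenisation.LagrangianCarrier (fderiv_comp_displacement)

variable {k : ℕ}

/-! ## §1 Lattice vectors are discrete -/

/-- A nonzero lattice vector has norm at least `1`. -/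
theorem one_le_norm_latticeVec' {m : Fin 3 → ℤ} (hm : m ≠ 0) : 1 ≤ ‖(latticeVec m : EuclideanSpace ℝ (Fin 3))‖ := by
  obtain ⟨i, hi⟩ : ∃ i, m i ≠ 0 := Function.ne_iff.1 hm
  have h1 : (1:ℝ) ≤ |(m i : ℝ)| := by
    rw [← Int.cast_abs]; exact_mod_cast Int.one_le_abs hi
  calc (1:ℝ) ≤ |(m i : ℝ)| := h1
    _ = ‖(latticeVec m : EuclideanSpace ℝ (Fin 3)) i‖ := by rw [latticeVec_apply, Real.norm_eq_abs]
    _ ≤ ‖(latticeVec m : EuclideanSpace ℝ (Fin 3))‖ := PiLp.norm_apply_le _ i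

/-- Two vectors with the same projection to the torus and at distance `< 1` are equal. -/
theorem eq_of_proj_eq_of_norm_sub_lt_one {x y : EuclideanSpace ℝ (Fin 3)} (hp : proj x = proj y) (hd : ‖y - x‖ < 1) : y = x := by
  obtain ⟨m, hm⟩ := (proj_eq_proj_iff_holds x y).1 hp
  by_cases h0 : m = 0
  · rw [hm, h0]
    ext i; simp
  · exfalso
    have h1 := one_le_norm_latticeVec' h0
    rw [hm, add_sub_cancel_left] at hd
    linarith

/-! ## §2 The displacement sum along a round trip is locally constant -/

/-- The round-trip displacement `F y = disp m s t' y + disp m t' s (X m s t' y)` projects to `0` (`X m t' s ∘ X m s t' = id`). -/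
theorem proj_roundTrip_eq_zero (E : LagrangianLatticeCarrier k) (hR : E.LevelRegular) (m : ℕ) (s t' : ℝ) (y : UnitAddTorus (Fin 3)) :
    proj (E.disp m s t' y + E.disp m t' s (E.X m s t' y)) = 0 := by
  have h := congrFun (hR.X_comp_X m t' s t') y
  rw [Function.comp_apply, hR.X_self m t'] at h
  -- `h : X m t' s (X m s t' y) = y`
  rw [LagrangianLatticeCarrier.X_apply E m t' s, LagrangianLatticeCarrier.X_apply E m s t', add_assoc, ← proj_add] at h
  have h2 : y + proj (E.disp m s t' y + E.disp m t' s (y + proj (E.disp m s t' y))) = y + 0 := by rw [add_zero]; exact h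
  have h3 := add_left_cancel h2
  rw [← LagrangianLatticeCarrier.X_apply] at h3
  exact h3

/-- The round-trip displacement is continuous in `y`. -/
theorem continuous_roundTrip (E : LagrangianLatticeCarrier k) (hR : E.LevelRegular) (m : ℕ) (s t' : ℝ) :
    Continuous fun y => E.disp m s t' y + E.disp m t' s (E.X m s t' y) := by
  have hc : ∀ t s : ℝ, Continuous fun y : UnitAddTorus (Fin 3) => E.disp m t s y := fun t s =>
    (hR.2.2.2.2.2.2.1 m s).comp (Continuous.prodMk_right t)
  have hX : Continuous (E.X m s t') := by
    have e : E.X m s t' = fun y => y + proj (E.disp m s t' y) := funext fun y => LagrangianLatticeCarrier.X_apply E m s t' y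
    rw [e]; exact continuous_id.add (continuous_proj.comp (hc s t'))
  exact (hc s t').add ((hc t' s).comp hX)

/-- The round-trip displacement is locally constant: eventually near every point it equals its value there. -/
theorem roundTrip_eventuallyEq (E : LagrangianLatticeCarrier k) (hR : E.LevelRegular) (m : ℕ) (s t' : ℝ) (y₀ : UnitAddTorus (Fin 3)) :
    ∀ᶠ y in 𝓝 y₀, E.disp m s t' y + E.disp m t' s (E.X m s t' y) = E.disp m s t' y₀ + E.disp m t' s (E.X m s t' y₀) := by
  set F := fun y => E.disp m s t' y + E.disp m t' s (E.X m s t' y) with hF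
  have hc := (continuous_roundTrip E hR m s t').continuousAt (x := y₀)
  have hball : ∀ᶠ y in 𝓝 y₀, dist (F y) (F y₀) < 1 := (Metric.tendsto_nhds.1 hc) 1 one_pos
  filter_upwards [hball] with y hy
  rw [dist_eq_norm] at hy
  exact eq_of_proj_eq_of_norm_sub_lt_one (by rw [proj_roundTrip_eq_zero E hR, proj_roundTrip_eq_zero E hR]) hy

/-- Hence its torus derivative vanishes. -/
theorem fderiv_roundTrip_eq_zero (E : LagrangianLatticeCarrier k) (hR : E.LevelRegular) (m : ℕ) (s t' : ℝ) (y₀ : UnitAddTorus (Fin 3)) :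
    Torus.fderiv (fun y => E.disp m s t' y + E.disp m t' s (E.X m s t' y)) y₀ = 0 := by
  unfold Torus.fderiv
  -- the re-centred lift is eventually constant near `0`
  have hcont : Continuous fun v : EuclideanSpace ℝ (Fin 3) => y₀ + proj v := continuous_const.add continuous_proj
  have h0 : (fun v : EuclideanSpace ℝ (Fin 3) => y₀ + proj v) 0 = y₀ := by simp [proj_zero]
  have hev := roundTrip_eventuallyEq E hR m s t' y₀
  have hev' : ∀ᶠ v in 𝓝 (0 : EuclideanSpace ℝ (Fin 3)),
      liftAt (fun y => E.disp m s t' y + E.disp m t' s (E.X m s t' y)) y₀ v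
        = E.disp m s t' y₀ + E.disp m t' s (E.X m s t' y₀) := by
    have ht : Tendsto (fun v : EuclideanSpace ℝ (Fin 3) => y₀ + proj v) (𝓝 0) (𝓝 y₀) := by
      have h := hcont.continuousAt (x := (0 : EuclideanSpace ℝ (Fin 3)))
      rw [ContinuousAt] at h
      simpa [proj_zero] using h
    filter_upwards [ht.eventually hev] with v hv
    simpa only [liftAt_apply] using hv
  rw [Filter.EventuallyEq.fderiv_eq (f := fun _ => E.disp m s t' y₀ + E.disp m t' s (E.X m s t' y₀)) hev']
  exact fderiv_const_apply _

/-! ## §3 The derivative group law and the invertibility of the frame Jacobian -/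

/-- `flowDeriv` on the torus derivative of the displacement: `flowDeriv m t s y = id + D(disp m t s)(y)`. -/
theorem flowDeriv_eq_id_add_fderiv (E : LagrangianLatticeCarrier k) (m : ℕ) (t s : ℝ) (y : UnitAddTorus (Fin 3)) :
    E.flowDeriv m t s y = ContinuousLinearMap.id ℝ _ + Torus.fderiv (E.disp m t s) y := by
  rw [LagrangianLatticeCarrier.flowDeriv, fderiv_lift, proj_repr]

/-- **The DERIVATIVE GROUP LAW at all times**: `flowDeriv m t' s (X m s t' y) (flowDeriv m s t' y w) = w`. -/
theorem flowDeriv_comp_inverse_apply (E : LagrangianLatticeCarrier k) (hR : E.LevelRegular) (m : ℕ) (s t' : ℝ)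
    (y : UnitAddTorus (Fin 3)) (w : EuclideanSpace ℝ (Fin 3)) :
    E.flowDeriv m t' s (E.X m s t' y) (E.flowDeriv m s t' y w) = w := by
  set u : UnitAddTorus (Fin 3) → EuclideanSpace ℝ (Fin 3) := E.disp m s t' with hu_def
  set θ : UnitAddTorus (Fin 3) → EuclideanSpace ℝ (Fin 3) := E.disp m t' s with hθ_def
  have hu : IsSmooth u := hR.isSmooth_disp m s t'
  have hθ : IsSmooth θ := hR.isSmooth_disp m t' s
  have hX : ∀ y, E.X m s t' y = y + proj (u y) := fun y => LagrangianLatticeCarrier.X_apply E m s t' y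
  -- `D(u + θ ∘ S) = Du + Dθ(S ·) ∘ (id + Du) = 0`
  have htop : ((⊤ : ℕ∞) : WithTop ℕ∞) ≠ 0 := by simp
  have h1 : Torus.fderiv (fun y => u y + θ (E.X m s t' y)) y
      = Torus.fderiv u y + (Torus.fderiv θ (y + proj (u y))).comp (ContinuousLinearMap.id ℝ _ + Torus.fderiv u y) := by
    rw [← fderiv_comp_displacement hθ hu y]
    unfold Torus.fderiv
    have e : liftAt (fun y => u y + θ (E.X m s t' y)) y = fun v => liftAt u y v + liftAt (fun x => θ (x + proj (u x))) y v := by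
      funext v; simp only [liftAt_apply, hX]
    rw [e]
    exact fderiv_add ((hu.liftAt y).differentiable htop 0)
      ((LagrangianCarrier.isSmooth_comp_displacement hθ hu).liftAt y |>.differentiable htop 0)
  have h0 := fderiv_roundTrip_eq_zero E hR m s t' y
  rw [h1] at h0
  -- evaluate at `w`: `Du w + Dθ(S y)(w + Du w) = 0`
  have h2 : Torus.fderiv u y w + Torus.fderiv θ (y + proj (u y)) (w + Torus.fderiv u y w) = 0 := by
    have h := congrArg (fun L : EuclideanSpace ℝ (Fin 3) →L[ℝ] EuclideanSpace ℝ (Fin 3) => L w) h0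
    simpa only [FunLike.coe_add, Pi.add_apply, ContinuousLinearMap.comp_apply, ContinuousLinearMap.id_apply,
      FunLike.coe_zero, Pi.zero_apply] using h
  rw [flowDeriv_eq_id_add_fderiv, flowDeriv_eq_id_add_fderiv, hX y]
  simp only [FunLike.coe_add, Pi.add_apply, ContinuousLinearMap.id_apply]
  -- `(w + Du w) + Dθ(S y)(w + Du w) = w`
  have e : w + Torus.fderiv u y w + Torus.fderiv θ (y + proj (u y)) (w + Torus.fderiv u y w)
      = w + (Torus.fderiv u y w + Torus.fderiv θ (y + proj (u y)) (w + Torus.fderiv u y w)) := by abel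
  rw [e, h2, add_zero]

/-- **The frame Jacobian is invertible at all times.** -/
theorem isUnit_frameJac (E : LagrangianLatticeCarrier k) (hR : E.LevelRegular) (m : ℕ) (t' s : ℝ) (x : UnitAddTorus (Fin 3)) :
    IsUnit (frameJac E m t' s x) := by
  -- `x = X m s t' y` with `y = X m t' s x`; a two-sided inverse matrix is the Jacobian of the inverse flow
  set y : UnitAddTorus (Fin 3) := E.X m t' s x with hy
  have hxy : E.X m s t' y = x := by
    have h := congrFun (hR.X_comp_X m s t' s) x
    rw [Function.comp_apply, hR.X_self m s] at h
    exact h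
  -- left inverse: `frameJac t' s x * frameJac s t' y = 1` from the group law at `y`
  have hmul : frameJac E m t' s x * frameJac E m s t' y = 1 := by
    refine Matrix.ext fun a c => ?_
    have h := flowDeriv_comp_inverse_apply E hR m s t' y (EuclideanSpace.single c (1:ℝ))
    rw [hxy] at h
    have h' := congrArg (fun v : EuclideanSpace ℝ (Fin 3) => v a) h
    simp only at h'
    rw [← frameJac_mulVec] at h'
    have e : WithLp.ofLp (E.flowDeriv m s t' y (EuclideanSpace.single c 1)) = fun b => frameJac E m s t' y b c := by
      funext b; rfl
    rw [e] at h'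
    rw [Matrix.mul_apply, Matrix.one_apply]
    simp only [Matrix.mulVec, dotProduct] at h'
    rw [h']
    simp [PiLp.single_apply]
  exact IsUnit.of_mul_eq_one _ hmul

end Summit.AnomalousDissipation.AnomalousDissipation.Theorems.SolenoidalFractalHomogenisation.LagrangianStep.FrameConj

end
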